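import Summits.AnomalousDissipation.AnomalousDissipation.Theorems.TaylorGreenLoudGalerkinStates.Negative.LoadBearing
import Literature.Analysis.FluidPDE.SteadyGalerkinApprox

/-!
# Negative knowledge for the crux `TaylorGreenLoudGalerkinStates` (stmt-AnomalousDissipation-2987), II:
# anatomy of a witness — the Fourier support of `f_TG`, the sharp injection ceiling, the high-mode dissipation floor

Certified copy of §2(b♯) and §2(c') of the cdisprove work file `Cruxes/TaylorGreenLoudGalerkinStates/Disproof.lean`
(refuter-cdisprove-stmt-AnomalousDissipation-2987-0). Supports stmt-AnomalousDissipation-2987; no positive route-item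
statement is asserted.

* `tgForce_eq_realTrigPoly` — `f_TG = realTrigPoly tgShell tgCoeff` with `tgShell = {±1}³` (`|k|² = 3`) and
  `f̂(k) = (i/8)(−k₀, k₁, 0)`; corollaries `isSmooth_tgForce`, `isDivFree_tgForce`, `hasZeroMean_tgForce`,
  `mFourierCoeff_tgForce`, `integral_norm_sq_tgForce : ∫‖f_TG‖² = 1/4`.
* `integral_inner_tgForce_eq_sum`, `integral_inner_tgForce_le_shell` — the injection `∫⟪f_TG, U⟫` is a sum over the
  shell and is `≤ ½ (Σ_{shell} ‖Û(k)‖²)^{1/2}`.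
* `loudness_le_half_sqrt_shellEnergy`, `loudness_le_half_sqrt_energy`, `not_loud_of_energy_lt_four_sq` — the SHARP
  constants window: `ν‖∇U‖² ≤ ½√E`, so the crux strengthened by `E < 4ε²` is FALSE.
* `shell_energy_floor` — a loud admissible TG state keeps energy `≥ 4ε²` on the forcing shell.
* `gradNormSq_le_low_add_high`, `high_mode_dissipation_floor` — for every cutoff `K`, a loud bounded admissible state
  (any force) dissipates `≥ ε − 4π²νK²E` in the modes `|k| > K`.
Net: every witness of the crux is a genuine steady cascade state (amplitude on `|k|² = 3`, enstrophy at `|k| ≳ ν^{-1/2}`).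
-/

noncomputable section

open scoped InnerProductSpace Topology ComplexConjugate
open MeasureTheory Filter
open Literature.Analysis.FunctionSpaces Literature.Analysis.FunctionSpaces.Torus

namespace Summit.AnomalousDissipation.AnomalousDissipation.Theorems.TaylorGreenLoudGalerkinStates.Negative

/-! ### (b♯) The sharp injection ceiling: `f_TG` lives on the shell `|k|² = 3`

`f_TG` is written as an explicit real trigonometric polynomial on the 8 wavevectors `(±1,±1,±1)` with coefficients
`f̂(k) = (i/8)(−k₀, k₁, 0)`; hence it is smooth, divergence free, mean zero (the regularity half of the line's
`stub_tgForceRegular`, recorded here because the anatomy needs the Fourier support), `‖f_TG‖²_{L²} = 1/4`, and the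
injection is carried by the TG shell: `∫⟪f_TG, U⟫ = Σ_{shell} Re⟪f̂(k), Û(k)⟫ ≤ ½ (Σ_{shell} ‖Û(k)‖²)^{1/2}`. -/

/-- The Taylor–Green shell: the 8 wavevectors `(±1, ±1, ±1)` (`|k|² = 3`). -/
def tgShell : Finset (Fin 3 → ℤ) := Fintype.piFinset fun _ : Fin 3 => ({1, -1} : Finset ℤ)

/-- The Fourier coefficients of `f_TG`: `f̂(k) = (i/8)(−k₀, k₁, 0)` (used on the TG shell). -/
def tgCoeff (k : Fin 3 → ℤ) : EuclideanSpace ℂ (Fin 3) :=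
  ((8⁻¹ : ℝ) : ℂ) • !₂[-(Complex.I * (k 0 : ℂ)), Complex.I * (k 1 : ℂ), 0]

/-- `1 ≠ -1` in `ℤ`. [folklore] -/
theorem one_ne_neg_one_int : (1 : ℤ) ≠ -1 := by decide

/-- The sum over the TG shell of a product `∏ⱼ g j (k j)` factorises. -/
theorem sum_tgShell_prod (g : Fin 3 → ℤ → ℂ) :
    ∑ k ∈ tgShell, ∏ j, g j (k j) = ∏ j, (g j 1 + g j (-1)) := by
  rw [tgShell, ← Finset.prod_univ_sum]
  refine Finset.prod_congr rfl fun j _ => ?_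
  rw [Finset.sum_pair one_ne_neg_one_int]

/-- The Fourier character on `T³` factors over the three coordinates. [folklore] -/
theorem mFourier_three (k : Fin 3 → ℤ) (x : UnitAddTorus (Fin 3)) :
    UnitAddTorus.mFourier k x = fourier (k 0) (x 0) * fourier (k 1) (x 1) * fourier (k 2) (x 2) := by
  simp [UnitAddTorus.mFourier, Fin.prod_univ_three]

/-- First component of `f_TG` as the shell sum: `Re Σ_{shell} e_k(x) f̂(k)₀ = sin2πx₀ cos2πx₁ cos2πx₂`. [folklore] -/
theorem tgForce_apply_zero (x : UnitAddTorus (Fin 3)) :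
    (∑ k ∈ tgShell, UnitAddTorus.mFourier k x * tgCoeff k 0).re = tgForce x 0 := by
  have h : ∀ k ∈ tgShell, UnitAddTorus.mFourier k x * tgCoeff k 0 =
      ∏ j, (![fun a : ℤ => fourier a (x 0) * (((8⁻¹ : ℝ) : ℂ) * -(Complex.I * (a : ℂ))),
        fun a : ℤ => (fourier a (x 1) : ℂ), fun a : ℤ => (fourier a (x 2) : ℂ)] : Fin 3 → ℤ → ℂ) j (k j) := by
    intro k _
    rw [mFourier_three, Fin.prod_univ_three]
    simp [tgCoeff]
    ring
  rw [Finset.sum_congr rfl h, sum_tgShell_prod, Fin.prod_univ_three]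
  simp only [Matrix.cons_val_zero, Matrix.cons_val_one, Matrix.cons_val_two, Matrix.head_cons, Matrix.tail_cons,
    fourier_neg, Int.cast_one, Int.cast_neg, tgForce, PiLp.toLp_apply]
  simp only [Complex.mul_re, Complex.mul_im, Complex.add_re, Complex.add_im, Complex.neg_re, Complex.neg_im,
    Complex.conj_re, Complex.conj_im, Complex.I_re, Complex.I_im, Complex.ofReal_re, Complex.ofReal_im,
    Complex.one_re, Complex.one_im, zero_mul, sub_zero, zero_sub, add_zero, zero_add, mul_one, one_mul]
  ring

/-- Second component of `f_TG` as the shell sum: `Re Σ_{shell} e_k(x) f̂(k)₁ = −cos2πx₀ sin2πx₁ cos2πx₂`. [folklore] -/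
theorem tgForce_apply_one (x : UnitAddTorus (Fin 3)) :
    (∑ k ∈ tgShell, UnitAddTorus.mFourier k x * tgCoeff k 1).re = tgForce x 1 := by
  have h : ∀ k ∈ tgShell, UnitAddTorus.mFourier k x * tgCoeff k 1 =
      ∏ j, (![fun a : ℤ => (fourier a (x 0) : ℂ),
        fun a : ℤ => fourier a (x 1) * (((8⁻¹ : ℝ) : ℂ) * (Complex.I * (a : ℂ))),
        fun a : ℤ => (fourier a (x 2) : ℂ)] : Fin 3 → ℤ → ℂ) j (k j) := by
    intro k _
    rw [mFourier_three, Fin.prod_univ_three]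
    simp [tgCoeff]
    ring
  rw [Finset.sum_congr rfl h, sum_tgShell_prod, Fin.prod_univ_three]
  simp only [Matrix.cons_val_zero, Matrix.cons_val_one, Matrix.cons_val_two, Matrix.head_cons, Matrix.tail_cons,
    fourier_neg, Int.cast_one, Int.cast_neg, tgForce, PiLp.toLp_apply]
  simp only [Complex.mul_re, Complex.mul_im, Complex.add_re, Complex.add_im, Complex.neg_re, Complex.neg_im,
    Complex.conj_re, Complex.conj_im, Complex.I_re, Complex.I_im, Complex.ofReal_re, Complex.ofReal_im,
    Complex.one_re, Complex.one_im, zero_mul, sub_zero, zero_sub, add_zero, zero_add, mul_one, one_mul]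
  ring

/-- Third component of `f_TG` vanishes, as does the shell sum of `f̂(k)₂ = 0`. [folklore] -/
theorem tgForce_apply_two (x : UnitAddTorus (Fin 3)) :
    (∑ k ∈ tgShell, UnitAddTorus.mFourier k x * tgCoeff k 2).re = tgForce x 2 := by
  simp [tgCoeff, tgForce]

/-- **`f_TG` is a real trigonometric polynomial on the Taylor–Green shell** with coefficients `tgCoeff`. -/
theorem tgForce_eq_realTrigPoly : tgForce = realTrigPoly tgShell tgCoeff := by
  funext x
  ext i
  rw [realTrigPoly_apply_coord, trigPoly_apply_coord]
  fin_cases i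
  · exact (tgForce_apply_zero x).symm
  · exact (tgForce_apply_one x).symm
  · exact (tgForce_apply_two x).symm

/-- The TG shell is symmetric under `k ↦ -k`. [folklore] -/
theorem neg_mem_tgShell : ∀ k ∈ tgShell, -k ∈ tgShell := by
  intro k hk
  rw [tgShell, Fintype.mem_piFinset] at hk ⊢
  intro j
  have hj := hk j
  simp only [Finset.mem_insert, Finset.mem_singleton, Pi.neg_apply] at hj ⊢
  rcases hj with h | h <;> simp [h]

/-- The mean mode is not on the TG shell. [folklore] -/
theorem zero_not_mem_tgShell : (0 : Fin 3 → ℤ) ∉ tgShell := by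
  rw [tgShell, Fintype.mem_piFinset]
  intro h
  have := h 0
  simp at this

/-- Coordinates of shell vectors square to one. [folklore] -/
theorem sq_eq_one_of_mem_tgShell {k : Fin 3 → ℤ} (hk : k ∈ tgShell) (j : Fin 3) : (k j : ℂ) ^ 2 = 1 := by
  rw [tgShell, Fintype.mem_piFinset] at hk
  have hj := hk j
  simp only [Finset.mem_insert, Finset.mem_singleton] at hj
  rcases hj with h | h <;> simp [h]

/-- The TG coefficients satisfy the reality condition `f̂(−k) = conj f̂(k)`. [folklore] -/
theorem isConjSymm_tgCoeff : IsConjSymm tgCoeff := by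
  intro k
  unfold tgCoeff
  ext i
  fin_cases i <;>
    simp [EuclideanSpace.conjVec_apply, Complex.ext_iff]

/-- The TG coefficients are transversal on the shell: `k · f̂(k) = (i/8)(k₁² − k₀²) = 0`. [folklore] -/
theorem isTransversal_tgCoeff : IsTransversal tgShell tgCoeff := by
  intro k hk
  have h0 := sq_eq_one_of_mem_tgShell hk 0
  have h1 := sq_eq_one_of_mem_tgShell hk 1
  simp only [tgCoeff, Fin.sum_univ_three, PiLp.smul_apply, smul_eq_mul, Matrix.cons_val_zero,
    Matrix.cons_val_one, Matrix.cons_val_two, Matrix.head_cons, Matrix.tail_cons]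
  linear_combination (((8⁻¹ : ℝ) : ℂ) * Complex.I) * (h1 - h0)

/-- `f_TG` is smooth (a trigonometric polynomial). [folklore] -/
theorem isSmooth_tgForce : IsSmooth tgForce := by
  rw [tgForce_eq_realTrigPoly]; exact isSmooth_realTrigPoly _ _

/-- `f_TG` is divergence free. [folklore] -/
theorem isDivFree_tgForce : IsDivFree tgForce := by
  rw [tgForce_eq_realTrigPoly]; exact isDivFree_realTrigPoly isTransversal_tgCoeff

/-- `f_TG` has zero mean. [folklore] -/
theorem hasZeroMean_tgForce : HasZeroMean tgForce := by
  rw [tgForce_eq_realTrigPoly]; exact Literature.Analysis.FluidPDE.hasZeroMean_realTrigPoly_of_zero_not_mem zero_not_mem_tgShell _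

/-- The Fourier coefficients of `f_TG`: `tgCoeff` on the TG shell, `0` elsewhere. -/
theorem mFourierCoeff_tgForce (k : Fin 3 → ℤ) :
    UnitAddTorus.mFourierCoeff (EuclideanSpace.complexify ∘ tgForce) k = if k ∈ tgShell then tgCoeff k else 0 := by
  rw [tgForce_eq_realTrigPoly]; exact mFourierCoeff_realTrigPoly neg_mem_tgShell isConjSymm_tgCoeff k

/-- `‖f̂(k)‖² = 1/32` on the shell. [folklore] -/
theorem norm_sq_tgCoeff {k : Fin 3 → ℤ} (hk : k ∈ tgShell) : ‖tgCoeff k‖ ^ 2 = 32⁻¹ := by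
  rw [tgShell, Fintype.mem_piFinset] at hk
  have h0 := hk 0
  have h1 := hk 1
  simp only [Finset.mem_insert, Finset.mem_singleton] at h0 h1
  rw [EuclideanSpace.norm_sq_eq, Fin.sum_univ_three]
  simp only [tgCoeff, PiLp.smul_apply, smul_eq_mul, Matrix.cons_val_zero,
    Matrix.cons_val_one, Matrix.cons_val_two, Matrix.head_cons, Matrix.tail_cons, norm_mul, norm_neg,
    Complex.norm_I, Complex.norm_real, Complex.norm_intCast, mul_zero, norm_zero]
  rcases h0 with h0 | h0 <;> rcases h1 with h1 | h1 <;> simp [h0, h1] <;> norm_num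

/-- The TG shell has 8 points. [folklore] -/
theorem card_tgShell : tgShell.card = 8 := by
  rw [tgShell, Fintype.card_piFinset]
  simp [Finset.card_pair one_ne_neg_one_int]

/-- `‖f_TG‖²_{L²} = ∑_{k ∈ shell} ‖f̂(k)‖² = 8 · 1/32 = 1/4`. -/
theorem sum_norm_sq_tgCoeff : ∑ k ∈ tgShell, ‖tgCoeff k‖ ^ 2 = 4⁻¹ := by
  rw [Finset.sum_congr rfl fun k hk => norm_sq_tgCoeff hk, Finset.sum_const, card_tgShell]
  norm_num

/-- `∫ ‖f_TG‖² = 1/4` (finite Parseval). [folklore] -/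
theorem integral_norm_sq_tgForce : ∫ x, ‖tgForce x‖ ^ 2 = 4⁻¹ := by
  rw [tgForce_eq_realTrigPoly, integral_norm_sq_realTrigPoly neg_mem_tgShell isConjSymm_tgCoeff, sum_norm_sq_tgCoeff]

/-- **Injection is carried by the TG shell**: `∫⟪f_TG, U⟫ = Σ_{k ∈ shell} Re⟪f̂(k), Û(k)⟫` for `U ∈ L²`. -/
theorem integral_inner_tgForce_eq_sum {U : UnitAddTorus (Fin 3) → EuclideanSpace ℝ (Fin 3)} (hU : MemLp U 2 volume) :
    ∫ x, ⟪tgForce x, U x⟫_ℝ =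
      ∑ k ∈ tgShell, (inner ℂ (tgCoeff k) (UnitAddTorus.mFourierCoeff (EuclideanSpace.complexify ∘ U) k)).re := by
  conv_lhs => rw [tgForce_eq_realTrigPoly]
  exact integral_inner_realTrigPoly_left neg_mem_tgShell isConjSymm_tgCoeff hU

/-- **Shell Cauchy–Schwarz**: `∫⟪f_TG, U⟫ ≤ ½ (Σ_{k ∈ shell} ‖Û(k)‖²)^{1/2}`. -/
theorem integral_inner_tgForce_le_shell {U : UnitAddTorus (Fin 3) → EuclideanSpace ℝ (Fin 3)} (hU : MemLp U 2 volume) :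
    ∫ x, ⟪tgForce x, U x⟫_ℝ ≤
      2⁻¹ * Real.sqrt (∑ k ∈ tgShell, ‖UnitAddTorus.mFourierCoeff (EuclideanSpace.complexify ∘ U) k‖ ^ 2) := by
  rw [integral_inner_tgForce_eq_sum hU]
  set b : (Fin 3 → ℤ) → ℝ := fun k => ‖UnitAddTorus.mFourierCoeff (EuclideanSpace.complexify ∘ U) k‖ with hb
  have h1 : ∑ k ∈ tgShell, (inner ℂ (tgCoeff k) (UnitAddTorus.mFourierCoeff (EuclideanSpace.complexify ∘ U) k)).re ≤
      ∑ k ∈ tgShell, ‖tgCoeff k‖ * b k := by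
    refine Finset.sum_le_sum fun k _ => ?_
    exact (Complex.re_le_norm _).trans (norm_inner_le_norm _ _)
  have h2 : (∑ k ∈ tgShell, ‖tgCoeff k‖ * b k) ^ 2 ≤ (∑ k ∈ tgShell, ‖tgCoeff k‖ ^ 2) * ∑ k ∈ tgShell, b k ^ 2 :=
    Finset.sum_mul_sq_le_sq_mul_sq _ _ _
  rw [sum_norm_sq_tgCoeff] at h2
  have hB : 0 ≤ ∑ k ∈ tgShell, b k ^ 2 := Finset.sum_nonneg fun _ _ => sq_nonneg _
  have h3 : ∑ k ∈ tgShell, ‖tgCoeff k‖ * b k ≤ Real.sqrt (4⁻¹ * ∑ k ∈ tgShell, b k ^ 2) :=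
    (le_abs_self _).trans (Real.abs_le_sqrt h2)
  have h4 : Real.sqrt (4⁻¹ * ∑ k ∈ tgShell, b k ^ 2) = 2⁻¹ * Real.sqrt (∑ k ∈ tgShell, b k ^ 2) := by
    rw [Real.sqrt_mul (by norm_num : (0 : ℝ) ≤ 4⁻¹), Real.sqrt_inv, show (4 : ℝ) = 2 ^ 2 by norm_num,
      Real.sqrt_sq (by norm_num : (0 : ℝ) ≤ 2)]
  exact h1.trans (h3.trans_eq h4)


/-- Bessel on the TG shell: `Σ_{k ∈ shell} ‖Û(k)‖² ≤ ∫ |U|²` for `U ∈ L²`. [folklore] -/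
theorem shellEnergy_le_energy {U : UnitAddTorus (Fin 3) → EuclideanSpace ℝ (Fin 3)} (hU : MemLp U 2 volume) :
    ∑ k ∈ tgShell, ‖UnitAddTorus.mFourierCoeff (EuclideanSpace.complexify ∘ U) k‖ ^ 2 ≤ ∫ x, ‖U x‖ ^ 2 :=
  sum_le_hasSum tgShell (fun _ _ => sq_nonneg _) (hasSum_sq_norm_mFourierCoeff_complexify hU)

/-- **Sharp injection ceiling through the forcing shell.** For an admissible state of the Taylor–Green force,
`ν‖∇U‖² = ∫⟪f_TG, U⟫ ≤ ½ (Σ_{k ∈ shell} ‖Û(k)‖²)^{1/2}`. [folklore] -/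
theorem loudness_le_half_sqrt_shellEnergy {ν : ℝ} {N : ℕ} {U : UnitAddTorus (Fin 3) → EuclideanSpace ℝ (Fin 3)}
    (hU : IsSteadyState ν N tgForce U) :
    ν * gradNormSq U ≤
      2⁻¹ * Real.sqrt (∑ k ∈ tgShell, ‖UnitAddTorus.mFourierCoeff (EuclideanSpace.complexify ∘ U) k‖ ^ 2) := by
  rw [energy_identity hU continuous_tgForce]
  exact integral_inner_tgForce_le_shell
    (hU.1.continuous.memLp_of_hasCompactSupport (HasCompactSupport.of_compactSpace _))

/-- **Sharp constants window**: `ν‖∇U‖² ≤ ½ √(∫|U|²)` (Cauchy–Schwarz with `‖f_TG‖_{L²} = ½`), so every witness of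
the crux has `4ε² ≤ E`. [folklore] -/
theorem loudness_le_half_sqrt_energy {ν : ℝ} {N : ℕ} {U : UnitAddTorus (Fin 3) → EuclideanSpace ℝ (Fin 3)}
    (hU : IsSteadyState ν N tgForce U) : ν * gradNormSq U ≤ 2⁻¹ * Real.sqrt (∫ x, ‖U x‖ ^ 2) := by
  refine (loudness_le_half_sqrt_shellEnergy hU).trans ?_
  have hmem : MemLp U 2 volume :=
    hU.1.continuous.memLp_of_hasCompactSupport (HasCompactSupport.of_compactSpace _)
  exact mul_le_mul_of_nonneg_left (Real.sqrt_le_sqrt (shellEnergy_le_energy hmem)) (by norm_num)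

/-- **Natural strengthening refuted (sharp form): `E < 4ε²`.** [folklore] -/
theorem not_loud_of_energy_lt_four_sq :
    ¬ ∃ (ν : ℕ → ℝ) (E ε : ℝ), (∀ j, 0 < ν j) ∧ Tendsto ν atTop (𝓝 0) ∧ 0 < ε ∧ E < 4 * ε ^ 2 ∧
        LoudAlong tgForce ν E ε := by
  rintro ⟨ν, E, ε, -, -, hε, hE, h⟩
  obtain ⟨N, U, hU, hUE, hloud⟩ := (h 0).exists
  have h1 := loudness_le_half_sqrt_energy hU
  have h2 : Real.sqrt (∫ x, ‖U x‖ ^ 2) ≤ Real.sqrt E := Real.sqrt_le_sqrt hUE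
  have h3 : Real.sqrt E < 2 * ε := by
    rw [Real.sqrt_lt' (by positivity)]
    nlinarith
  nlinarith

/-- **Forcing-shell amplitude floor (anatomy of a witness).** A loud admissible state of the Taylor–Green force keeps
energy `≥ 4ε²` on the forcing shell `|k|² = 3` — while (`high_mode_dissipation_floor`) its enstrophy escapes to
`|k| → ∞`: the two ends of a cascade, both forced by the statement itself. [folklore] -/
theorem shell_energy_floor {ν ε : ℝ} {N : ℕ} {U : UnitAddTorus (Fin 3) → EuclideanSpace ℝ (Fin 3)}
    (hU : IsSteadyState ν N tgForce U) (hε : 0 ≤ ε) (hloud : ε ≤ ν * gradNormSq U) :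
    4 * ε ^ 2 ≤ ∑ k ∈ tgShell, ‖UnitAddTorus.mFourierCoeff (EuclideanSpace.complexify ∘ U) k‖ ^ 2 := by
  set S := ∑ k ∈ tgShell, ‖UnitAddTorus.mFourierCoeff (EuclideanSpace.complexify ∘ U) k‖ ^ 2 with hS
  have hS0 : 0 ≤ S := Finset.sum_nonneg fun _ _ => sq_nonneg _
  have h1 : ε ≤ 2⁻¹ * Real.sqrt S := hloud.trans (loudness_le_half_sqrt_shellEnergy hU)
  have h2 : 2 * ε ≤ Real.sqrt S := by linarith
  have h3 : (2 * ε) ^ 2 ≤ Real.sqrt S ^ 2 := pow_le_pow_left₀ (by linarith) h2 2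
  rw [Real.sq_sqrt hS0] at h3
  linarith


/-! ### (c') Anatomy: the dissipation of a loud bounded state sits at high wavenumbers -/

/-- The spectral enstrophy of `U` carried by the modes `K² < |k|² ≤ N²` (times `4π²`):
`4π² Σ_{k ∈ freqBall N, K² < |k|²} |k|² ‖Û k‖²`. -/
def highEnstrophy (K : ℝ) (N : ℕ) (U : UnitAddTorus (Fin 3) → EuclideanSpace ℝ (Fin 3)) : ℝ :=
  4 * Real.pi ^ 2 * ∑ k ∈ (freqBall N).filter (fun k => K ^ 2 < freqNormSq k),
    freqNormSq k * ‖UnitAddTorus.mFourierCoeff (EuclideanSpace.complexify ∘ U) k‖ ^ 2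

/-- `highEnstrophy` is nonnegative. [folklore] -/
theorem highEnstrophy_nonneg (K : ℝ) (N : ℕ) (U : UnitAddTorus (Fin 3) → EuclideanSpace ℝ (Fin 3)) :
    0 ≤ highEnstrophy K N U :=
  mul_nonneg (by positivity) (Finset.sum_nonneg fun k _ =>
    mul_nonneg (Finset.sum_nonneg fun i _ => sq_nonneg _) (sq_nonneg _))

/-- **Low/high splitting of the enstrophy (Bernstein on the low modes).** For a smooth field band-limited to
`|k|² ≤ N²` and any cutoff `K`: `‖∇U‖² ≤ 4π²K² ∫|U|² + highEnstrophy K N U`. [folklore] -/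
theorem gradNormSq_le_low_add_high {U : UnitAddTorus (Fin 3) → EuclideanSpace ℝ (Fin 3)} (hU : IsSmooth U)
    {N : ℕ} (hband : IsBandLimited N U) (K : ℝ) :
    gradNormSq U ≤ 4 * Real.pi ^ 2 * K ^ 2 * (∫ x, ‖U x‖ ^ 2) + highEnstrophy K N U := by
  have hband' : ∀ k : Fin 3 → ℤ, (N : ℝ) ^ 2 < freqNormSq k →
      UnitAddTorus.mFourierCoeff (EuclideanSpace.complexify ∘ U) k = 0 := fun k hk =>
    hband k fun hmem => (not_mem_freqBall.2 hk) (Finset.mem_of_mem_erase hmem)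
  set w : (Fin 3 → ℤ) → ℝ := fun k =>
    freqNormSq k * ‖UnitAddTorus.mFourierCoeff (EuclideanSpace.complexify ∘ U) k‖ ^ 2 with hw
  set e : (Fin 3 → ℤ) → ℝ := fun k =>
    ‖UnitAddTorus.mFourierCoeff (EuclideanSpace.complexify ∘ U) k‖ ^ 2 with he
  have hnn : 0 ≤ 4 * Real.pi ^ 2 * ∑ k ∈ freqBall N, w k :=
    mul_nonneg (by positivity) (Finset.sum_nonneg fun k _ =>
      mul_nonneg (Finset.sum_nonneg fun i _ => sq_nonneg _) (sq_nonneg _))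
  have hgrad : gradNormSq U = 4 * Real.pi ^ 2 * ∑ k ∈ freqBall N, w k := by
    rw [gradNormSq_eq_toReal_eGradNormSq_holds hU, eGradNormSq_eq_sum_of_band_limited hU.continuous hband',
      ENNReal.toReal_ofReal hnn]
  have henergy : ∫ x, ‖U x‖ ^ 2 = ∑ k ∈ freqBall N, e k :=
    integral_norm_sq_eq_sum_of_band_limited hU.continuous hband'
  have hsplit := Finset.sum_filter_add_sum_filter_not (freqBall N) (fun k => K ^ 2 < freqNormSq k) w
  -- the low modes: `|k|² ≤ K²`
  have hlow : ∑ k ∈ (freqBall N).filter (fun k => ¬ K ^ 2 < freqNormSq k), w k ≤ K ^ 2 * ∑ k ∈ freqBall N, e k := by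
    calc ∑ k ∈ (freqBall N).filter (fun k => ¬ K ^ 2 < freqNormSq k), w k
        ≤ ∑ k ∈ (freqBall N).filter (fun k => ¬ K ^ 2 < freqNormSq k), K ^ 2 * e k := by
          refine Finset.sum_le_sum fun k hk => ?_
          have hk' : freqNormSq k ≤ K ^ 2 := not_lt.1 (Finset.mem_filter.1 hk).2
          exact mul_le_mul_of_nonneg_right hk' (sq_nonneg _)
      _ = K ^ 2 * ∑ k ∈ (freqBall N).filter (fun k => ¬ K ^ 2 < freqNormSq k), e k := by rw [Finset.mul_sum]
      _ ≤ K ^ 2 * ∑ k ∈ freqBall N, e k := by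
          refine mul_le_mul_of_nonneg_left ?_ (sq_nonneg _)
          exact Finset.sum_le_sum_of_subset_of_nonneg (Finset.filter_subset _ _) fun k _ _ => sq_nonneg _
  rw [hgrad, henergy, highEnstrophy, ← hsplit]
  have hpi : 0 ≤ 4 * Real.pi ^ 2 := by positivity
  nlinarith [mul_le_mul_of_nonneg_left hlow hpi]

/-- **High-mode dissipation floor (anatomy of a witness).** A loud bounded admissible state at `(ν, N)` (any force)
dissipates at least `ε − 4π²νK²E` in the modes `|k| > K`, for every cutoff `K`: with `K² = ε/(8π²νE)` at least half of
the dissipation sits at wavenumbers `|k| > (ε/8π²νE)^{1/2} → ∞` as `ν → 0`. [folklore] -/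
theorem high_mode_dissipation_floor {ν E ε : ℝ} {N : ℕ} {f U : UnitAddTorus (Fin 3) → EuclideanSpace ℝ (Fin 3)}
    (hν : 0 ≤ ν) (hU : IsSteadyState ν N f U) (hE : ∫ x, ‖U x‖ ^ 2 ≤ E) (hloud : ε ≤ ν * gradNormSq U) (K : ℝ) :
    ε - 4 * Real.pi ^ 2 * ν * K ^ 2 * E ≤ ν * highEnstrophy K N U := by
  have h := gradNormSq_le_low_add_high hU.1 hU.2.2.2.1 K
  have h1 : ν * gradNormSq U ≤ ν * (4 * Real.pi ^ 2 * K ^ 2 * (∫ x, ‖U x‖ ^ 2) + highEnstrophy K N U) :=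
    mul_le_mul_of_nonneg_left h hν
  have h2 : ν * (4 * Real.pi ^ 2 * K ^ 2 * ∫ x, ‖U x‖ ^ 2) ≤ ν * (4 * Real.pi ^ 2 * K ^ 2 * E) := by
    refine mul_le_mul_of_nonneg_left ?_ hν
    exact mul_le_mul_of_nonneg_left hE (by positivity)
  nlinarith [h1, h2]

end Summit.AnomalousDissipation.AnomalousDissipation.Theorems.TaylorGreenLoudGalerkinStates.Negative

end
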